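import Literature.NumberTheory.IwasawaTheory.ClassicalMuVanishesTransportAlgEquivTwo
import Literature.NumberTheory.NumberFields.NarrowClassNumberRingEquiv
import HarnessLib

set_option autoImplicit false

/-!
# Transport of the NARROW and wide class numbers of the LAYERS of the cyclotomic `ℤ₂`-tower along a `ℚ`-isomorphism of number
# fields of ANY degree, given `√2 ∉ E`

Topic `NumberTheory/IwasawaTheory` (namespace = path). THEOREM-ONLY file (no definition, no named fact, no `sorry`), written by the prover seat
`bsd-line-att-p4` g32 (cell `bsd-f1-sign2`; `--supports` stmt-BirchSwinnertonDyer-22298). Companion of `ClassicalMuVanishesTransportAlgEquivTwo`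
(same seat's lineage, g31: `e_n`, `μ = 0`, `λ` transport along `E ≃ₐ[ℚ] E'` given `√2 ∉ E`). The Kida-lite / narrow-defect currency of the tree
(`NarrowDefectBoundedOfClassicalMuAdjoinI`, `ClassicalMuVanishesAdjoinIOfNarrow`: hypotheses on `ord₂ h⁺(E_n)` and `ord₂ h(E_n)` of the layers
`E_n` of a cyclotomic `ℤ₂`-extension of `E`) is stated on MODELS `E ⊆ ℚ̄`; this file moves such layer-wise hypotheses to any `ℚ`-isomorphic field:

* `layer_eq_of_isCyclotomic` — two cyclotomic `ℤ_p`-extensions of one field have the same layers (unit twist, `layer_unitTwist`).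
* `nonempty_ringEquiv_layer_of_algEquiv_of_forall_sq_ne_two` — `φ : E ≃ₐ[ℚ] E'`, `√2 ∉ E`, `κ, κ'` cyclotomic: **`E_n ≃+* E'_n`** for every `n`.
* `padicValNat_narrowClassNumber_layer_eq_of_algEquiv_of_forall_sq_ne_two` — `φ : E ≃ₐ[ℚ] E'`, `√2 ∉ E`, `κ, κ'` cyclotomic `ℤ₂`-extensions of `E, E'`:
  **`ord₂ h⁺(E_n) = ord₂ h⁺(E'_n)`** for every `n` (both layers are ring-isomorphic to `j(E')·ℚ_n ⊆ ℚ̄`, `nonempty_ringEquiv_layer_restrict_fieldRange_sup_layer`,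
  and `h⁺` is a ring-isomorphism invariant, `narrowClassNumber_eq_of_ringEquiv`); `padicValNat_classNumber_layer_eq_of_algEquiv_of_forall_sq_ne_two` (the
  same for `h`, i.e. `e_n` in class-number currency).
* `exists_narrowDefect_le_iff_of_algEquiv_of_forall_sq_ne_two` — the Kida-lite datum «`∃ D, ∀` cyclotomic `κ`, `∀ n`, `ord₂ h⁺(E_n) ≤ ord₂ h(E_n) + D`»
  is invariant under `E ≃ₐ[ℚ] E'` (given `√2 ∉ E`).

References: [Washington1997] §13.1 (`ℚ_1 = ℚ(√2)`; the layers `E·ℚ_n`); [FrohlichTaylor1990] Ch. V §1 (1.12) (`h⁺·#sign(U) = h·2^{r₁}`);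
[Kida1982JFields] Thm. 1 (the narrow `μ⁺`); tree: `ClassicalMuVanishesTransportAlgEquivTwo`, `ZpExtensionRestrictLayerCompositum`
(`nonempty_ringEquiv_layer_restrict_fieldRange_sup_layer`), `NarrowClassNumberRingEquiv`.
-/

noncomputable section

open scoped NumberField

namespace Literature.NumberTheory.IwasawaTheory

open Field Literature.NumberTheory.EllipticCurves Literature.NumberTheory.EllipticCurves.ZpExtension
  Literature.NumberTheory.GaloisRepresentations Literature.NumberTheory.NumberFields

/-- **Two cyclotomic `ℤ_p`-extensions of the same field have the same layers** (they differ by a unit twist, which does not move the layers).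
[cite: Washington1997, §13.1] -/
theorem layer_eq_of_isCyclotomic {K : Type} [Field K] {p : ℕ} [Fact p.Prime] (κ₁ κ₂ : ZpExtension K p)
    (h₁ : κ₁.IsCyclotomic) (h₂ : κ₂.IsCyclotomic) (n : ℕ) : κ₁.layer n = κ₂.layer n := by
  obtain ⟨u, hu⟩ := ZpExtension.IsCyclotomic.exists_eq_unitTwist_holds h₁ h₂
  rw [hu, κ₁.layer_unitTwist u n]

variable {E E' : Type} [Field E] [NumberField E] [Field E'] [NumberField E']

/-- `√2 ∉ E` passes along a `ℚ`-isomorphism. [folklore] -/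
private theorem forall_sq_ne_two_of_algEquiv' (φ : E ≃ₐ[ℚ] E') (h2 : ∀ x : E, x ^ 2 ≠ 2) : ∀ x' : E', x' ^ 2 ≠ 2 := fun x' hx' ↦
  h2 (φ.symm x') (by rw [← map_pow, hx', map_ofNat])

/-- **The layers of the cyclotomic `ℤ₂`-towers of `ℚ`-isomorphic fields are ring-isomorphic: `E_n ≃+* E'_n`** for `φ : E ≃ₐ[ℚ] E'`, `√2 ∉ E`,
`κ, κ'` cyclotomic `ℤ₂`-extensions of `E, E'` (both towers are the restrictions of the cyclotomic tower `κ₀` of `ℚ`, whose `n`-th layers are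
ring-isomorphic to `j(E')·ℚ_n ⊆ ℚ̄` for the embedding `j` of `E'` resp. `j ∘ φ` of `E`). [cite: Washington1997, §13.1] -/
theorem nonempty_ringEquiv_layer_of_algEquiv_of_forall_sq_ne_two (φ : E ≃ₐ[ℚ] E') (h2 : ∀ x : E, x ^ 2 ≠ 2)
    (κ : ZpExtension E 2) (hκ : κ.IsCyclotomic) (κ' : ZpExtension E' 2) (hκ' : κ'.IsCyclotomic) (n : ℕ) :
    Nonempty (↥(κ.layer n) ≃+* ↥(κ'.layer n)) := by
  obtain ⟨κ₀, hκ₀⟩ := exists_cyclotomicZpExtension_holds ℚ 2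
  have hE := surjective_comp_absGaloisRestrict_of_forall_sq_ne_two' κ₀ E hκ₀ h2
  have hE' := surjective_comp_absGaloisRestrict_of_forall_sq_ne_two' κ₀ E' hκ₀ (forall_sq_ne_two_of_algEquiv' φ h2)
  set j : E' →ₐ[ℚ] AlgebraicClosure ℚ := absEmbedding ℚ E' with hj
  -- the layers of `κ`, `κ'` are those of the restricted towers
  have h1 : κ.layer n = (κ₀.restrict E hE).layer n := layer_eq_of_isCyclotomic κ _ hκ (isCyclotomic_restrict κ₀ hκ₀ E hE) n
  have h1' : κ'.layer n = (κ₀.restrict E' hE').layer n := layer_eq_of_isCyclotomic κ' _ hκ' (isCyclotomic_restrict κ₀ hκ₀ E' hE') n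
  -- ring isomorphisms with the composita `j(E')·ℚ_n`
  obtain ⟨e₁⟩ := nonempty_ringEquiv_layer_restrict_fieldRange_sup_layer κ₀ E hE (j.comp (φ : E →ₐ[ℚ] E')) n
  obtain ⟨e₂⟩ := nonempty_ringEquiv_layer_restrict_fieldRange_sup_layer κ₀ E' hE' j n
  have hrange : (j.comp (φ : E →ₐ[ℚ] E')).fieldRange = j.fieldRange := by
    ext y
    simp only [AlgHom.mem_fieldRange, AlgHom.coe_comp, Function.comp_apply]
    constructor
    · rintro ⟨x, rfl⟩
      exact ⟨φ x, rfl⟩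
    · rintro ⟨x', rfl⟩
      exact ⟨φ.symm x', congrArg j (φ.apply_symm_apply x')⟩
  have e₃ : ↥((j.comp (φ : E →ₐ[ℚ] E')).fieldRange ⊔ κ₀.layer n) ≃+* ↥(j.fieldRange ⊔ κ₀.layer n) :=
    (IntermediateField.equivOfEq (by rw [hrange])).toRingEquiv
  exact ⟨(IntermediateField.equivOfEq h1).toRingEquiv.trans <| e₁.trans <| e₃.trans <| e₂.symm.trans
    (IntermediateField.equivOfEq h1').symm.toRingEquiv⟩

/-- **The NARROW class numbers of the layers transport: `ord₂ h⁺(E_n) = ord₂ h⁺(E'_n)`** for `φ : E ≃ₐ[ℚ] E'`, `√2 ∉ E` (`∀ x : E, x² ≠ 2`), `κ, κ'`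
cyclotomic `ℤ₂`-extensions of `E, E'`, every `n`, and ANY `NumberField` instances on the layers (`h⁺` is invariant under ring isomorphisms,
`narrowClassNumber_eq_of_ringEquiv`). [cite: Washington1997, §13.1] [cite: FrohlichTaylor1990, Ch. V §1 (1.12), p. 164] -/
theorem padicValNat_narrowClassNumber_layer_eq_of_algEquiv_of_forall_sq_ne_two (φ : E ≃ₐ[ℚ] E') (h2 : ∀ x : E, x ^ 2 ≠ 2)
    (κ : ZpExtension E 2) (hκ : κ.IsCyclotomic) (κ' : ZpExtension E' 2) (hκ' : κ'.IsCyclotomic) (n : ℕ)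
    [NumberField ↥(κ.layer n)] [NumberField ↥(κ'.layer n)] :
    padicValNat 2 (narrowClassNumber ↥(κ.layer n)) = padicValNat 2 (narrowClassNumber ↥(κ'.layer n)) :=
  padicValNat_narrowClassNumber_eq_of_ringEquiv 2 (nonempty_ringEquiv_layer_of_algEquiv_of_forall_sq_ne_two φ h2 κ hκ κ' hκ' n).some

/-- **The class numbers of the layers transport: `ord₂ h(E_n) = ord₂ h(E'_n)`** (same hypotheses; the class-number currency of
`classNumberPExp_eq_of_algEquiv_of_forall_sq_ne_two`, for ANY `NumberField` instances on the layers). [cite: Washington1997, §13.1] -/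
theorem padicValNat_classNumber_layer_eq_of_algEquiv_of_forall_sq_ne_two (φ : E ≃ₐ[ℚ] E') (h2 : ∀ x : E, x ^ 2 ≠ 2)
    (κ : ZpExtension E 2) (hκ : κ.IsCyclotomic) (κ' : ZpExtension E' 2) (hκ' : κ'.IsCyclotomic) (n : ℕ)
    [NumberField ↥(κ.layer n)] [NumberField ↥(κ'.layer n)] :
    padicValNat 2 (NumberField.classNumber ↥(κ.layer n)) = padicValNat 2 (NumberField.classNumber ↥(κ'.layer n)) := by
  rw [← classNumberPExp_eq_padicValNat_classNumber, ← classNumberPExp_eq_padicValNat_classNumber]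
  exact classNumberPExp_eq_of_algEquiv_of_forall_sq_ne_two φ h2 κ hκ κ' hκ' n

/-- **The Kida-lite narrow-defect datum transports along `E ≃ₐ[ℚ] E'` (given `√2 ∉ E`)**: «there is `D` with `ord₂ h⁺(E_n) ≤ ord₂ h(E_n) + D` for every
cyclotomic `ℤ₂`-extension of `E` and every layer `n`» iff the same for `E'`. [cite: Kida1982JFields, Thm. 1 (the narrow invariants μ⁺, λ⁺)]
[cite: Washington1997, §13.1] -/
theorem exists_narrowDefect_le_iff_of_algEquiv_of_forall_sq_ne_two (φ : E ≃ₐ[ℚ] E') (h2 : ∀ x : E, x ^ 2 ≠ 2) :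
    (∃ D : ℕ, ∀ κ : ZpExtension E 2, κ.IsCyclotomic → ∀ n : ℕ, ∀ [NumberField ↥(κ.layer n)],
        padicValNat 2 (narrowClassNumber ↥(κ.layer n)) ≤ padicValNat 2 (NumberField.classNumber ↥(κ.layer n)) + D) ↔
      ∃ D : ℕ, ∀ κ' : ZpExtension E' 2, κ'.IsCyclotomic → ∀ n : ℕ, ∀ [NumberField ↥(κ'.layer n)],
        padicValNat 2 (narrowClassNumber ↥(κ'.layer n)) ≤ padicValNat 2 (NumberField.classNumber ↥(κ'.layer n)) + D := by
  obtain ⟨κ₁, hκ₁⟩ := exists_cyclotomicZpExtension_holds E 2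
  obtain ⟨κ₂, hκ₂⟩ := exists_cyclotomicZpExtension_holds E' 2
  constructor
  · rintro ⟨D, hD⟩
    refine ⟨D, fun κ' hκ' n _ ↦ ?_⟩
    haveI : NumberField ↥(κ₁.layer n) :=
      haveI : FiniteDimensional E ↥(κ₁.layer n) := κ₁.finiteDimensional_layer_holds n
      NumberField.of_module_finite E _
    rw [← padicValNat_narrowClassNumber_layer_eq_of_algEquiv_of_forall_sq_ne_two φ h2 κ₁ hκ₁ κ' hκ' n,
      ← padicValNat_classNumber_layer_eq_of_algEquiv_of_forall_sq_ne_two φ h2 κ₁ hκ₁ κ' hκ' n]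
    exact hD κ₁ hκ₁ n
  · rintro ⟨D, hD⟩
    refine ⟨D, fun κ hκ n _ ↦ ?_⟩
    haveI : NumberField ↥(κ₂.layer n) :=
      haveI : FiniteDimensional E' ↥(κ₂.layer n) := κ₂.finiteDimensional_layer_holds n
      NumberField.of_module_finite E' _
    rw [padicValNat_narrowClassNumber_layer_eq_of_algEquiv_of_forall_sq_ne_two φ h2 κ hκ κ₂ hκ₂ n,
      padicValNat_classNumber_layer_eq_of_algEquiv_of_forall_sq_ne_two φ h2 κ hκ κ₂ hκ₂ n]
    exact hD κ₂ hκ₂ n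

end Literature.NumberTheory.IwasawaTheory

end
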